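import Summits.SmoothPoincare4.SmoothPoincare4.Theorems.SymplecticOrigamiOrigamiFoldExistenceStubOuterCleanRecognitionGlue
import Literature.Topology.FourManifolds.SphereHypersurfaceSides

/-!
# Stub `stub_outerCleanRecognitionChart` of line `shadow-pleats` for crux `OrigamiFoldExistence` — A:
# the CHIMNEY of an outer-clean chart (item stmt-SmoothPoincare4-7844, route SymplecticOrigami; seat c3, S4''-chart worker)

First helper file towards the registered stub `stub_outerCleanRecognitionChart :
OuterCleanRecognitionChart` (the one geometric ingredient of outer-clean recognition, file
`…StubOuterCleanRecognitionGlue`).  Of the nine clauses of `OuterCleanRecognitionChart` the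
four TOPOLOGICAL ones (the lifted chimney `U ⊆ S⁴` is open and connected, has connected
exterior `(closure U)ᶜ`, and `frontier U` is the lifted outer crease) are settled here, for
EVERY `1`-chart pleated position whose chart is outer-clean, from the tree's Jordan–Brouwer
package for smooth hypersurface spheres (`Literature/Topology/FourManifolds/SphereHypersurfaceSides`:
tube data `TubeData f`, side function `TubeData.sideFun`, `IsSidePackage`) applied to the lifted
crease `f = liftedCrease ι (e 0) : S³ ↪ S⁴` (a smooth embedding, `isSmoothEmbedding_liftedCrease`):

* `sideσ D` — the side function of tube data `D` of the lifted crease, SIGN-NORMALISED to be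
  positive at the north pole `N` (`N` is not on the crease: it is not in the range of the lift
  `λ = liftS4`); `isSidePackage_sideσ`, `sideσ_northPole_pos`;
* `chimney D := {sideσ D < 0}` — the LIFTED CHIMNEY (the complementary component of the crease
  not containing `N`, i.e. the lift of the bounded component of `ℝ⁴ ∖ c_out`), and
  `exterior D := {0 < sideσ D} ∋ N`; the four clauses `isOpen_chimney`, `isConnected_chimney`,
  `isConnected_compl_closure_chimney`, `frontier_chimney`, plus `northPole_notMem_closure_chimney`,
  `chimney_subset_range_liftS4`, the decomposition `S⁴ = chimney ⊔ crease ⊔ exterior`;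
* `exists_chimney` (registered helper) — the bundled existence statement over the line
  vocabulary.

What is NOT here: the map `Φ` (clauses 5–9), which needs the side lemma (O1) of the lead's
`OuterClean-analysis-c3.md` §2 and the outer-collar structure of the fold (files B, C, …).

Sources: R. J. Daverman, *Decompositions of manifolds* (1986) Thm. II.6.6; M. W. Hirsch,
*Differential Topology* (1976) Ch. 4 §5; the lead's `OuterClean-analysis-c3.md` §3 (O2).
-/

noncomputable section

-- the prescribed namespace `Summit.<P>.<Sub>.…` duplicates `SmoothPoincare4` (P = Sub)
set_option linter.dupNamespace false

open scoped Manifold ContDiff Topology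
open Set Function Metric
open Literature.Topology.FourManifolds Literature.Topology.FourManifolds.SphereHypersurfaceSides

namespace Summit.SmoothPoincare4.SmoothPoincare4.Theorems.OrigamiFoldExistence.ShadowPleats

/-! ### The lift misses the north pole -/

/-- `λ = σ_N⁻¹` lands in the source `{N}ᶜ` of the stereographic chart. -/
theorem liftS4_mem_source (x : EuclideanSpace ℝ (Fin 4)) :
    liftS4 x ∈ (stereographic' 4 northPole).source :=
  (stereographic' 4 northPole).map_target (by rw [stereographic'_target]; exact mem_univ _)

/-- The lift never hits the north pole. -/
theorem liftS4_ne_northPole (x : EuclideanSpace ℝ (Fin 4)) : liftS4 x ≠ northPole := by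
  have h := liftS4_mem_source x
  rw [stereographic'_source] at h
  exact h

/-- `σ_N ∘ λ = id`. -/
@[simp] theorem stereographic'_liftS4 (x : EuclideanSpace ℝ (Fin 4)) :
    stereographic' 4 northPole (liftS4 x) = x :=
  (stereographic' 4 northPole).right_inv (by rw [stereographic'_target]; exact mem_univ _)

/-- `λ ∘ σ_N = id` off the north pole. -/
theorem liftS4_stereographic' {z : Metric.sphere (0 : EuclideanSpace ℝ (Fin 5)) 1} (hz : z ≠ northPole) :
    liftS4 (stereographic' 4 northPole z) = z :=
  (stereographic' 4 northPole).left_inv (by rw [stereographic'_source]; exact hz)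

/-- The range of the lift is exactly `S⁴ ∖ {N}`. -/
theorem range_liftS4 : range liftS4 = {northPole}ᶜ := by
  ext z
  constructor
  · rintro ⟨x, rfl⟩
    exact liftS4_ne_northPole x
  · intro hz
    exact ⟨stereographic' 4 northPole z, liftS4_stereographic' hz⟩

/-- The stereographic chart is continuous off the north pole. -/
theorem continuousOn_stereographic' :
    ContinuousOn (stereographic' 4 northPole) {northPole}ᶜ := by
  rw [← stereographic'_source (n := 4) northPole]
  exact (stereographic' 4 northPole).continuousOn

/-- A compact subset of `S⁴` missing `N` has BOUNDED preimage under the lift (it is the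
continuous image of the compact set under `σ_N`). -/
theorem isBounded_preimage_liftS4 {K : Set (Metric.sphere (0 : EuclideanSpace ℝ (Fin 5)) 1)}
    (hK : IsCompact K) (hN : northPole ∉ K) : Bornology.IsBounded (liftS4 ⁻¹' K) := by
  have hsub : K ⊆ {northPole}ᶜ := fun z hz h => hN (h ▸ hz)
  have himg : liftS4 ⁻¹' K = stereographic' 4 northPole '' K := by
    ext x
    constructor
    · intro hx
      exact ⟨liftS4 x, hx, stereographic'_liftS4 x⟩
    · rintro ⟨z, hz, rfl⟩
      show liftS4 (stereographic' 4 northPole z) ∈ K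
      rw [liftS4_stereographic' (hsub hz)]
      exact hz
  rw [himg]
  exact (hK.image_of_continuousOn (continuousOn_stereographic'.mono hsub)).isBounded

section Crease

variable {M : Type} [TopologicalSpace M] [ChartedSpace (EuclideanSpace ℝ (Fin 4)) M]
  {ι : M → EuclideanSpace ℝ (Fin 5)} {δ : ℝ} {e : Fin 1 → EuclideanSpace ℝ (Fin 4) → M}

/-- The range of the stage map at radius `2` is the image of the sphere `S(0,2)`. -/
theorem range_radialSphere_two (G : EuclideanSpace ℝ (Fin 4) → EuclideanSpace ℝ (Fin 4)) :
    range (radialSphere G 2) = G '' Metric.sphere 0 2 := by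
  ext y
  simp only [mem_range, mem_image, radialSphere]
  constructor
  · rintro ⟨x, rfl⟩
    refine ⟨(2 : ℝ) • (x : EuclideanSpace ℝ (Fin 4)), ?_, rfl⟩
    rw [mem_sphere_zero_iff_norm, norm_smul, Real.norm_ofNat, norm_eq_of_mem_sphere x, mul_one]
  · rintro ⟨u, hu, rfl⟩
    have hu2 : ‖u‖ = 2 := mem_sphere_zero_iff_norm.1 hu
    refine ⟨⟨(2 : ℝ)⁻¹ • u, ?_⟩, ?_⟩
    · rw [mem_sphere_zero_iff_norm, norm_smul, norm_inv, Real.norm_ofNat, hu2]; norm_num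
    · simp [smul_smul]

omit [TopologicalSpace M] [ChartedSpace (EuclideanSpace ℝ (Fin 4)) M] in
/-- The range of the lifted crease is the lift of the outer crease `c_out = proj5 ι e₀(S(0,2))`. -/
theorem range_liftedCrease (ι : M → EuclideanSpace ℝ (Fin 5)) (e₀ : EuclideanSpace ℝ (Fin 4) → M) :
    range (liftedCrease ι e₀) = (liftS4 ∘ proj5 ∘ ι ∘ e₀) '' Metric.sphere 0 2 := by
  rw [liftedCrease, range_comp, range_radialSphere_two, ← image_comp]

omit [TopologicalSpace M] [ChartedSpace (EuclideanSpace ℝ (Fin 4)) M] in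
/-- The north pole is not on the lifted crease. -/
theorem northPole_notMem_range_liftedCrease (ι : M → EuclideanSpace ℝ (Fin 5))
    (e₀ : EuclideanSpace ℝ (Fin 4) → M) : northPole ∉ range (liftedCrease ι e₀) := by
  rintro ⟨x, hx⟩
  exact liftS4_ne_northPole _ hx

end Crease

/-! ### The sign-normalised side function, the chimney and the exterior -/

section Chimney

variable {f : Metric.sphere (0 : EuclideanSpace ℝ (Fin 4)) 1 → Metric.sphere (0 : EuclideanSpace ℝ (Fin 5)) 1}

/-- The SIGN of the tube side function at the north pole (`±1` when `N ∉ range f`). -/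
def poleSign (D : TubeData f) : ℝ := Real.sign (D.sideFun northPole)

/-- The side function of the tube data `D`, normalised to be POSITIVE AT THE NORTH POLE. -/
def sideσ (D : TubeData f) (z : Metric.sphere (0 : EuclideanSpace ℝ (Fin 5)) 1) : ℝ :=
  poleSign D * D.sideFun z

/-- The LIFTED CHIMNEY: the side of the crease not containing the north pole. -/
def chimney (D : TubeData f) : Set (Metric.sphere (0 : EuclideanSpace ℝ (Fin 5)) 1) :=
  {z | sideσ D z < 0}

/-- The EXTERIOR: the side of the crease containing the north pole. -/
def exterior (D : TubeData f) : Set (Metric.sphere (0 : EuclideanSpace ℝ (Fin 5)) 1) :=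
  {z | 0 < sideσ D z}

variable (D : TubeData f)

/-- Off the crease the side function does not vanish, so the pole sign is `±1`. -/
theorem poleSign_eq_or (hN : northPole ∉ range f) : poleSign D = 1 ∨ poleSign D = -1 := by
  have h0 : D.sideFun northPole ≠ 0 := by
    intro h
    have : northPole ∈ D.sideFun ⁻¹' {0} := h
    rw [(D.isSidePackage_sideFun (by norm_num)).preimage_zero] at this
    exact hN this
  rcases Real.sign_apply_eq (D.sideFun northPole) with h | h | h
  · exact Or.inr h
  · exact absurd (Real.sign_eq_zero_iff.1 h) h0
  · exact Or.inl h

/-- **The normalised side function is a side package for the crease.** [folklore] -/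
theorem isSidePackage_sideσ (hN : northPole ∉ range f) : IsSidePackage (range f) (sideσ D) := by
  rcases poleSign_eq_or D hN with h | h
  · have : sideσ D = D.sideFun := by funext z; simp [sideσ, h]
    rw [this]
    exact D.isSidePackage_sideFun (by norm_num)
  · have : sideσ D = fun z => -D.sideFun z := by funext z; simp [sideσ, h]
    rw [this]
    exact (D.isSidePackage_sideFun (by norm_num)).neg

/-- The normalised side function is positive at the north pole. -/
theorem sideσ_northPole_pos (hN : northPole ∉ range f) : 0 < sideσ D northPole := by
  have h0 : D.sideFun northPole ≠ 0 := by
    intro h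
    have : northPole ∈ D.sideFun ⁻¹' {0} := h
    rw [(D.isSidePackage_sideFun (by norm_num)).preimage_zero] at this
    exact hN this
  show 0 < Real.sign (D.sideFun northPole) * D.sideFun northPole
  rcases h0.lt_or_gt with h | h
  · rw [Real.sign_of_neg h]; nlinarith
  · rw [Real.sign_of_pos h]; nlinarith

/-- The normalised side function is smooth. -/
theorem contMDiff_sideσ (hN : northPole ∉ range f) : ContMDiff (𝓡 4) 𝓘(ℝ, ℝ) ∞ (sideσ D) :=
  (isSidePackage_sideσ D hN).contMDiff

/-- The normalised side function is continuous. -/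
theorem continuous_sideσ (hN : northPole ∉ range f) : Continuous (sideσ D) :=
  (isSidePackage_sideσ D hN).continuous

/-- In the tube, near the core, the normalised side function is the signed fibre coordinate. -/
theorem sideσ_tube (x : Metric.sphere (0 : EuclideanSpace ℝ (Fin 4)) 1) (w : EuclideanSpace ℝ (Fin 1))
    (hw : |w 0| ≤ 1 / 4) : sideσ D (D.τ (x, w)) = poleSign D * w 0 := by
  have hw' : w 0 ∈ Icc (-1 : ℝ) 1 := by
    constructor <;> linarith [abs_le.1 hw]
  rw [sideσ, D.apply_eq_collar x w hw', D.sideFun_collar (by norm_num), satProfile_eq_self hw]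

/-- CLAUSE 1: the chimney is open. -/
theorem isOpen_chimney (hN : northPole ∉ range f) : IsOpen (chimney D) :=
  (isSidePackage_sideσ D hN).isOpen_neg

/-- The exterior is open. -/
theorem isOpen_exterior (hN : northPole ∉ range f) : IsOpen (exterior D) :=
  (isSidePackage_sideσ D hN).isOpen_pos

/-- CLAUSE 2: the chimney is connected. -/
theorem isConnected_chimney (hN : northPole ∉ range f) : IsConnected (chimney D) :=
  (isSidePackage_sideσ D hN).isConnected_neg

/-- The exterior is connected. -/
theorem isConnected_exterior (hN : northPole ∉ range f) : IsConnected (exterior D) :=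
  (isSidePackage_sideσ D hN).isConnected_pos

/-- The closure of the chimney is `{σ ≤ 0}` (chimney plus crease). -/
theorem closure_chimney (hN : northPole ∉ range f) : closure (chimney D) = {z | sideσ D z ≤ 0} :=
  (isSidePackage_sideσ D hN).closure_neg

/-- The complement of the closure of the chimney is the exterior. -/
theorem compl_closure_chimney (hN : northPole ∉ range f) : (closure (chimney D))ᶜ = exterior D := by
  rw [closure_chimney D hN]
  ext z
  simp [exterior]

/-- CLAUSE 3: the exterior of the chimney is connected. -/
theorem isConnected_compl_closure_chimney (hN : northPole ∉ range f) :
    IsConnected (closure (chimney D))ᶜ := by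
  rw [compl_closure_chimney D hN]
  exact isConnected_exterior D hN

/-- CLAUSE 4: the frontier of the chimney is the crease. -/
theorem frontier_chimney (hN : northPole ∉ range f) : frontier (chimney D) = range f :=
  (isSidePackage_sideσ D hN).frontier_neg

/-- The frontier of the exterior is the crease as well. -/
theorem frontier_exterior (hN : northPole ∉ range f) : frontier (exterior D) = range f :=
  (isSidePackage_sideσ D hN).frontier_pos

/-- The north pole lies in the exterior. -/
theorem northPole_mem_exterior (hN : northPole ∉ range f) : northPole ∈ exterior D :=
  sideσ_northPole_pos D hN

/-- The north pole is not in the closure of the chimney. -/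
theorem northPole_notMem_closure_chimney (hN : northPole ∉ range f) : northPole ∉ closure (chimney D) := by
  rw [closure_chimney D hN]
  exact fun h => absurd (sideσ_northPole_pos D hN) (not_lt.2 h)

/-- The chimney, the crease and the exterior partition the sphere. -/
theorem mem_chimney_or (z : Metric.sphere (0 : EuclideanSpace ℝ (Fin 5)) 1) :
    z ∈ chimney D ∨ sideσ D z = 0 ∨ z ∈ exterior D := by
  rcases lt_trichotomy (sideσ D z) 0 with h | h | h
  · exact Or.inl h
  · exact Or.inr (Or.inl h)
  · exact Or.inr (Or.inr h)

/-- The crease is the zero set of the normalised side function. -/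
theorem sideσ_eq_zero_iff (hN : northPole ∉ range f) (z : Metric.sphere (0 : EuclideanSpace ℝ (Fin 5)) 1) :
    sideσ D z = 0 ↔ z ∈ range f := by
  rw [← (isSidePackage_sideσ D hN).preimage_zero]
  rfl

/-- The chimney misses the crease. -/
theorem disjoint_chimney_range (hN : northPole ∉ range f) : Disjoint (chimney D) (range f) :=
  Set.disjoint_left.2 fun z (hz : sideσ D z < 0) hz' => hz.ne ((sideσ_eq_zero_iff D hN z).2 hz')

/-- The exterior misses the crease. -/
theorem disjoint_exterior_range (hN : northPole ∉ range f) : Disjoint (exterior D) (range f) :=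
  Set.disjoint_left.2 fun z (hz : 0 < sideσ D z) hz' => hz.ne' ((sideσ_eq_zero_iff D hN z).2 hz')

/-- The chimney and the exterior are disjoint. -/
theorem disjoint_chimney_exterior : Disjoint (chimney D) (exterior D) :=
  Set.disjoint_left.2 fun _ (h1 : sideσ D _ < 0) (h2 : 0 < sideσ D _) => lt_asymm h1 h2

/-- The closed chimney is compact and misses the north pole, so the chimney lies in the range of
the lift and has bounded preimage in `ℝ⁴` (it is the lift of the BOUNDED component). -/
theorem isBounded_preimage_liftS4_closure_chimney (hN : northPole ∉ range f) :
    Bornology.IsBounded (liftS4 ⁻¹' closure (chimney D)) :=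
  isBounded_preimage_liftS4 isClosed_closure.isCompact (northPole_notMem_closure_chimney D hN)

/-- The chimney lies in the range of the lift. -/
theorem chimney_subset_range_liftS4 (hN : northPole ∉ range f) : chimney D ⊆ range liftS4 := by
  rw [range_liftS4]
  intro z hz h
  exact northPole_notMem_closure_chimney D hN (h ▸ subset_closure hz)

/-- A connected subset of `S⁴` missing the crease and meeting the chimney lies in the chimney. -/
theorem subset_chimney_of_isPreconnected (hN : northPole ∉ range f)
    {W : Set (Metric.sphere (0 : EuclideanSpace ℝ (Fin 5)) 1)} (hW : IsPreconnected W)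
    (hWf : Disjoint W (range f)) (hmeet : (W ∩ chimney D).Nonempty) : W ⊆ chimney D := by
  have hsub : W ⊆ chimney D ∪ exterior D := fun z hz => by
    rcases mem_chimney_or D z with h | h | h
    · exact Or.inl h
    · exact absurd ((sideσ_eq_zero_iff D hN z).1 h) (Set.disjoint_left.1 hWf hz)
    · exact Or.inr h
  exact hW.subset_left_of_subset_union (isOpen_chimney D hN) (isOpen_exterior D hN)
    (disjoint_chimney_exterior D) hsub hmeet

/-- A connected subset of `S⁴` missing the crease and meeting the exterior lies in the exterior. -/
theorem subset_exterior_of_isPreconnected (hN : northPole ∉ range f)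
    {W : Set (Metric.sphere (0 : EuclideanSpace ℝ (Fin 5)) 1)} (hW : IsPreconnected W)
    (hWf : Disjoint W (range f)) (hmeet : (W ∩ exterior D).Nonempty) : W ⊆ exterior D := by
  have hsub : W ⊆ exterior D ∪ chimney D := fun z hz => by
    rcases mem_chimney_or D z with h | h | h
    · exact Or.inr h
    · exact absurd ((sideσ_eq_zero_iff D hN z).1 h) (Set.disjoint_left.1 hWf hz)
    · exact Or.inl h
  exact hW.subset_left_of_subset_union (isOpen_exterior D hN) (isOpen_chimney D hN)
    (disjoint_chimney_exterior D).symm hsub hmeet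

/-- **An UNBOUNDED connected subset of `ℝ⁴` missing the crease lifts into the exterior** (the
exterior is the lift of the unbounded component of `ℝ⁴ ∖ c_out`, plus `N`). [folklore] -/
theorem liftS4_image_subset_exterior (hN : northPole ∉ range f) {W : Set (EuclideanSpace ℝ (Fin 4))}
    (hW : IsPreconnected W) (hWf : Disjoint (liftS4 '' W) (range f)) (hWb : ¬ Bornology.IsBounded W) :
    liftS4 '' W ⊆ exterior D := by
  have hpre : IsPreconnected (liftS4 '' W) := hW.image liftS4 contMDiff_liftS4.continuous.continuousOn
  have hsub : liftS4 '' W ⊆ chimney D ∪ exterior D := fun z hz => by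
    rcases mem_chimney_or D z with h | h | h
    · exact Or.inl h
    · exact absurd ((sideσ_eq_zero_iff D hN z).1 h) (Set.disjoint_left.1 hWf hz)
    · exact Or.inr h
  rcases hpre.subset_or_subset (isOpen_chimney D hN) (isOpen_exterior D hN)
    (disjoint_chimney_exterior D) hsub with h | h
  · exfalso
    refine hWb ((isBounded_preimage_liftS4_closure_chimney D hN).subset fun x hx => ?_)
    exact subset_closure (h (mem_image_of_mem liftS4 hx))
  · exact h

end Chimney

/-! ### The registered helper -/

/-- **The CHIMNEY of an outer-clean chart (clauses 1–4 of `OuterCleanRecognitionChart`).**  For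
a `1`-chart pleated round-rim position `(ι, δ, e)` whose chart is outer-clean (the chart shadow is
injective on the outer fold sphere `S(0,2)`) there is a smooth `σ : S⁴ → ℝ`, positive at the north
pole, whose zero set is the lifted outer crease `λ(proj5 ι e₀(S(0,2)))`, such that the chimney
`U = {σ < 0}` is open and connected with connected exterior `(closure U)ᶜ = {σ > 0} ∌ N` … `∋ N`
and `frontier U` is the lifted crease (Jordan–Brouwer for the smooth hypersurface sphere
`liftedCrease ι (e 0)`, via the tree's side package). [folklore] -/
theorem exists_chimney {M : Type} [TopologicalSpace M] [ChartedSpace (EuclideanSpace ℝ (Fin 4)) M]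
    {ι : M → EuclideanSpace ℝ (Fin 5)} {δ : ℝ} {e : Fin 1 → EuclideanSpace ℝ (Fin 4) → M}
    (h : IsPleatedPosition ι δ e) (hclean : Set.InjOn (proj5 ∘ ι ∘ e 0) (Metric.sphere 0 2)) :
    ∃ σ : Metric.sphere (0 : EuclideanSpace ℝ (Fin 5)) 1 → ℝ,
      ContMDiff (𝓡 4) 𝓘(ℝ, ℝ) ∞ σ ∧ 0 < σ northPole ∧
      σ ⁻¹' {0} = (liftS4 ∘ proj5 ∘ ι ∘ e 0) '' Metric.sphere 0 2 ∧
      IsOpen {z | σ z < 0} ∧ IsConnected {z | σ z < 0} ∧ IsConnected (closure {z | σ z < 0})ᶜ ∧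
      frontier {z | σ z < 0} = (liftS4 ∘ proj5 ∘ ι ∘ e 0) '' Metric.sphere 0 2 ∧
      northPole ∉ closure {z | σ z < 0} := by
  have hf := isSmoothEmbedding_liftedCrease h hclean
  obtain ⟨D⟩ := nonempty_tubeData hf
  have hN := northPole_notMem_range_liftedCrease ι (e 0)
  refine ⟨sideσ D, contMDiff_sideσ D hN, sideσ_northPole_pos D hN, ?_, isOpen_chimney D hN,
    isConnected_chimney D hN, isConnected_compl_closure_chimney D hN, ?_,
    northPole_notMem_closure_chimney D hN⟩
  · rw [(isSidePackage_sideσ D hN).preimage_zero, range_liftedCrease]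
  · rw [← range_liftedCrease]
    exact frontier_chimney D hN

end Summit.SmoothPoincare4.SmoothPoincare4.Theorems.OrigamiFoldExistence.ShadowPleats

end
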